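import Mathlib.Data.ZMod.Basic
import Mathlib.Data.Finset.Powerset
import Mathlib.Data.Finset.Card
import Mathlib.Data.Fintype.Prod
import Mathlib.Data.Fintype.Powerset
import HarnessLib

/-!
# The four-core `X₀ × X₁ × X₂ × X₃` of a PAIR-FLIP sextic CM field (Galois closure of degree 24 or 48 — the stage-1
# field class): the 24-point model, its generating weights (12 conjugate pairs + ONE orbit of 6 face 4-sets), and the
# kernel census in degree 1

COR-CM (cell `pub-hodgecm2`), binder seat b25 (gen 37), count-neutral own lane; work item **W-b** of the lead's
B01-SIZE §4 T2 («relation-lattice / Pohlmann census of the four PerL types under `Gal(L/ℚ)`, order 24/48»).  A finite,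
kernel-decided computation in the format of `Census/DihedralSexticPair(Curve).lean` (b30) and
`Census/DihedralFourCoreSpecies.lean` (lit-andre-3): a few bookkeeping definitions of the model, `decide` theorems;
no named fact, no geometry, no `sorry`.  Companion (structural, all powers, no `decide` on configurations):
`Census/PairFlipSexticFourCorePowers.lean`.

SETTING.  `K` a sextic CM field whose Galois closure `L` has degree 24 or 48 over `ℚ`, i.e. (p2,
`CorCM/SexticCMFieldPairFlip.lean`, `CorCM/GenericCMFieldPairFlipCriteria.lean`) `Gal(L/ℚ) = (ℤ/2)³ ⋊ C₃` resp.
`(ℤ/2)³ ⋊ S₃ = ℤ/2 ≀ S₃` acting on `Hom(K, ℂ) = {(i, s)}` (`i ∈ ℤ/3` a real place of `K⁺`, `s` a sign) by moving places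
and flipping signs place by place («pair flips»); these are exactly the fields of the stage-1 statement `PerL`
(`[L:ℚ] ∈ {24, 48}`).  `K` has `8` CM types `Φ_ε = {(i, ε_i)}`, `ε ∈ {±}³`, ONE Galois orbit, all primitive and
nondegenerate; up to `Aut K = {1, c}` they give FOUR pairwise non-isogenous simple CM threefolds `X₀, X₁, X₂, X₃` of types
`(+,+,+)`, `(−,+,+)`, `(+,−,+)`, `(+,+,−)` (p2: `isSimple_of_finrank_normalClosure`, `isNondegenerate_of_finrank_normalClosure`;
HC holds unconditionally on every product of at most three of them, `hodgeConjectureFor_prod_of_card_le_three_of_finrank_normalClosure`,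
and `X₀ × X₁ × X₂ × X₃` carries an exceptional rational `(2,2)`-class, `exists_exceptional_two_biproduct_of_finrank_eq_six`).

MODEL.  Points `Pt = (factor b : Fin 4, place i : ℤ/3, sign s : Bool)` — the 24 complex embeddings indexing a CM
eigenbasis of `H¹(X₀ × X₁ × X₂ × X₃)`; the group element `(j, f, e)` acts by `i ↦ ±i + j` on places (`f` = reflect) and
then flips the sign at the places marked by `e : Bool × Bool × Bool` (`act`; the 48 maps `act j f e` are `ℤ/2 ≀ S₃`, the 24
maps `act j false e` are `(ℤ/2)³ ⋊ C₃`; complex conjugation is `act 0 false (true, true, true)`).  The CM type `phi`: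
factor `0` is `(+,+,+)`, factor `b ≥ 1` has sign `−` exactly at place `b − 1`.  A weight `S ⊆ Pt` (a class monomial
`⋀_{x ∈ S} e_x ∈ H^{|S|}`) is a Hodge class iff it is BALANCED: `#{x ∈ S | g·x ∈ Φ} = #{x ∈ S | g·x ∉ Φ}` for every `g`
(Pohlmann's criterion for the CM algebra `K⁴`, [cite: GaoUllmo2025, Thm 3.1 eq. (3.2)] [cite: Pohlmann1968, Thm 1];
`balanced` for all 48 maps, `balanced₂₄` for the 24 — for a closure-24 field only the latter are Galois conditions).

GENERATING WEIGHTS (`gens`, `12 + 6 = 18`): the conjugate pairs `{x, c·x}` (divisor classes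
[cite: Gordon1999HodgeAVSurvey, 9.2.2]) and the FACE 4-sets `face i s = {(0, i, s), (1, i, ¬s), (2, i, ¬s), (3, i, ¬s)}`
(one embedding over the real place `i` from each factor, signs `(s, ¬s, ¬s, ¬s)` = the sign relation
`ε⁰ − ε¹ − ε² − ε³ = 0` of the four type vectors, p2 `exists_sign_relation_of_finrank_eq_six`; Hodge type `(2,2)` on the
12-fold `X₀ × X₁ × X₂ × X₃`; the six of them are ONE orbit under either group).

RESULTS (kernel, `decide`):
* `isCMType_phi` — `phi` is a CM type for the involution `c`; `gens_balanced` — every generating weight is balanced for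
  all 48 maps (a fortiori for the 24); faces have 4 points, 2 in the type.
* `face_orbit` — the six faces are ONE orbit already under the 24 maps; `balanced_two_classification` — degree 1 of the
  census of `Q = X₀ × X₁ × X₂ × X₃`: a balanced 2-set is a conjugate pair (`B¹(Q) = D¹(Q)`, Picard number 12).
  Higher degrees from the exact oracle only (a kernel `decide` over the 4-subsets of 24 points exceeds the farm budget):
  `72 = 66 + 6` balanced 4-sets (two-pair unions + the 6 faces: `dim_ℚ B²(Q) = 72`, exceptional part of rank 6 = the
  face species, p2's class and its conjugates, nothing else), `268 = 220 + 48` balanced 6-sets (`48` = face ⊔ pair).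
The ALL-DEGREES, ALL-POWERS statement (every balanced configuration of any product of powers `X₀^a × X₁^b × X₂^c × X₃^d`
— in particular every balanced weight of `Q` — is a disjoint union of lifted pairs and faces; Hodge lattice
`= ℤ⟨12 pairs, 3 faces⟩`, rank 15, index 1) is PROVED STRUCTURALLY (no `decide`) in the companion file.  DICTIONARY (cited, formalised downstream in the transfer file): weight lines of disjoint
unions are cup products (`CorCM/CMWeightLinesDisjointUnion.lean`), pairs index divisor monomials, so
`B•(X₀^a × ⋯ × X₃^d)` is generated by divisors and the face species: **the Hodge conjecture for every abelian variety
isogenous to a product of powers of `X₀, …, X₃` is equivalent to the algebraicity of the face class of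
`X₀ × X₁ × X₂ × X₃`** — the rank-four face class of the stage-1 period statement for this field class.
HONEST FRAMING: nothing here is a case of the Hodge conjecture; `HC_CM` is not used and NOT proved.

## References
* [Pohlmann1968] H. Pohlmann, Algebraic cycles on abelian varieties of complex multiplication type, Ann. of Math. 88
  (1968) 161–180, Thm 1.
* [GaoUllmo2025] Z. Gao, E. Ullmo, J. Inst. Math. Jussieu 25 (2025) = arXiv:2411.12249, Thm 3.1 (eq. (3.2)).
* [Gordon1999HodgeAVSurvey] B. B. Gordon, A survey of the Hodge conjecture for abelian varieties, CRM Monogr. 10 (1999), 9.2.2.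
* [Deligne1982HodgeCycles] P. Deligne (notes by J. S. Milne), LNM 900 (1982), §5 (c).
* [Dodson1984] B. Dodson, The structure of Galois groups of CM-fields, Trans. AMS 283 (1984), §5.1 (the four
  ρ-structures in degree 6: orders 6, 12, 24, 48).

## Provenance
Exact python first (seat folder `work/fourcore6*.py`, < 5 s each): forms of rank 9 for both groups, Hodge lattice of
rank 15 with Smith invariants `1¹⁵` over `⟨pairs, faces⟩`, 5831 non-empty balanced subsets of `Q` all of which are
disjoint unions of pairs and faces, minimal ones = 12 pairs + 6 faces, counts 12 / 72 / 268 in sizes 2 / 4 / 6.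
-/

namespace Summit.HodgeConjecture.CorCM.Census.PairFlipSexticFourCore

open Finset

/-! ### The model -/

/-- Points of `Q = X₀ × X₁ × X₂ × X₃`: `(factor b, place i, sign s)` — the complex embedding of the `b`-th copy of `K`
over the real place `i` with sign `s`. [cite: GaoUllmo2025, §2.1] -/
abbrev Pt : Type := Fin 4 × ZMod 3 × Bool

/-- The sign flip prescribed by `e : Bool × Bool × Bool` at the place `i ∈ ℤ/3`. [folklore] -/
def flipAt (e : Bool × Bool × Bool) (i : ZMod 3) : Bool :=
  if i = 0 then e.1 else if i = 1 then e.2.1 else e.2.2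

/-- The element `(j, f, e)` of `ℤ/2 ≀ S₃ = (ℤ/2)³ ⋊ S₃`: places `i ↦ ±i + j` (`f` = reflect first), then the sign is
flipped at the places marked by `e`; the factor is untouched (diagonal action on `Hom(K⁴, ℚ̄) = ⊔₄ Hom(K, ℚ̄)`).  The 24
maps with `f = false` form the subgroup `(ℤ/2)³ ⋊ C₃` (Galois group of a closure-24 field). [cite: Dodson1984, §5.1] -/
def act (j : ZMod 3) (f : Bool) (e : Bool × Bool × Bool) : Pt → Pt
  | (b, i, s) => (b, (if f then -i else i) + j, xor s (flipAt e ((if f then -i else i) + j)))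

/-- Unfolding of `act` on a point. [folklore] -/
theorem act_apply (j : ZMod 3) (f : Bool) (e : Bool × Bool × Bool) (b : Fin 4) (i : ZMod 3) (s : Bool) :
    act j f e (b, i, s) = (b, (if f then -i else i) + j, xor s (flipAt e ((if f then -i else i) + j))) := rfl

/-- Complex conjugation `c = act 0 false (true, true, true)` flips the sign and nothing else. [folklore] -/
theorem act_conj (b : Fin 4) (i : ZMod 3) (s : Bool) : act 0 false (true, true, true) (b, i, s) = (b, i, !s) := by
  rw [act_apply]
  simp only [Bool.false_eq_true, ↓reduceIte, add_zero]
  have h : flipAt (true, true, true) i = true := by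
    unfold flipAt; split_ifs <;> rfl
  rw [h, Bool.xor_true]

/-- The CM type of `Q`: factor `0` is `(+,+,+)`; factor `b ≥ 1` has sign `−` exactly at place `b − 1`
(types `(−,+,+)`, `(+,−,+)`, `(+,+,−)` of `X₁, X₂, X₃`). [folklore] -/
def phi : Finset Pt :=
  {((0 : Fin 4), (0 : ZMod 3), true), (0, 1, true), (0, 2, true),
   (1, 0, false), (1, 1, true), (1, 2, true),
   (2, 0, true), (2, 1, false), (2, 2, true),
   (3, 0, true), (3, 1, true), (3, 2, false)}

/-- Pohlmann's condition for all 48 maps `act j f e` (the Galois conditions for a closure-48 field).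
[cite: GaoUllmo2025, Thm 3.1 eq. (3.2)] -/
def balanced (S : Finset Pt) : Bool :=
  decide (∀ g : ZMod 3 × Bool × (Bool × Bool × Bool),
    (S.filter fun x => act g.1 g.2.1 g.2.2 x ∈ phi).card = (S.filter fun x => act g.1 g.2.1 g.2.2 x ∉ phi).card)

/-- Pohlmann's condition for the 24 maps `act j false e` only (the Galois conditions for a closure-24 field).
[cite: GaoUllmo2025, Thm 3.1 eq. (3.2)] -/
def balanced₂₄ (S : Finset Pt) : Bool :=
  decide (∀ g : ZMod 3 × (Bool × Bool × Bool),
    (S.filter fun x => act g.1 false g.2 x ∈ phi).card = (S.filter fun x => act g.1 false g.2 x ∉ phi).card)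

/-- The 48 conditions imply the 24. [folklore] -/
theorem balanced₂₄_of_balanced {S : Finset Pt} (h : balanced S = true) : balanced₂₄ S = true := by
  rw [balanced, decide_eq_true_eq] at h
  rw [balanced₂₄, decide_eq_true_eq]
  intro g
  exact h (g.1, false, g.2)

/-! ### The generating weights -/

/-- The conjugate pair `{x, c·x}` (a divisor weight). [cite: Gordon1999HodgeAVSurvey, 9.2.2] -/
def conjPair (x : Pt) : Finset Pt := {x, act 0 false (true, true, true) x}

/-- **The face weight** `face i s = {(0, i, s), (1, i, ¬s), (2, i, ¬s), (3, i, ¬s)}`: one embedding over the place `i`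
from each of the four factors, with the signs of the relation `ε⁰ − ε¹ − ε² − ε³ = 0` among the four type vectors
(Hodge type `(2,2)` on the 12-fold `X₀ × X₁ × X₂ × X₃`; the rank-four face class). [cite: Pohlmann1968, Thm 1] -/
def face (i : ZMod 3) (s : Bool) : Finset Pt := {((0 : Fin 4), i, s), (1, i, !s), (2, i, !s), (3, i, !s)}

/-- The eighteen generating weights: 12 conjugate pairs and 6 faces. [folklore] -/
def gens : Finset (Finset Pt) :=
  univ.image conjPair ∪ univ.image fun is : ZMod 3 × Bool => face is.1 is.2

/-- Membership in `gens`, unfolded. [folklore] -/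
theorem mem_gens_iff (g : Finset Pt) : g ∈ gens ↔ (∃ x, g = conjPair x) ∨ ∃ i s, g = face i s := by
  rw [gens, Finset.mem_union, Finset.mem_image, Finset.mem_image]
  constructor
  · rintro (⟨x, -, rfl⟩ | ⟨⟨i, s⟩, -, rfl⟩)
    · exact Or.inl ⟨x, rfl⟩
    · exact Or.inr ⟨i, s, rfl⟩
  · rintro (⟨x, rfl⟩ | ⟨i, s, rfl⟩)
    · exact Or.inl ⟨x, Finset.mem_univ _, rfl⟩
    · exact Or.inr ⟨(i, s), Finset.mem_univ _, rfl⟩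

/-- Membership in a conjugate pair. [folklore] -/
theorem mem_conjPair_iff (x y : Pt) : y ∈ conjPair x ↔ y = x ∨ y = act 0 false (true, true, true) x := by
  rw [conjPair, Finset.mem_insert, Finset.mem_singleton]

/-- Membership in a face: `(0, i, s)` or `(b, i, ¬s)` with `b ≠ 0`. [folklore] -/
theorem mem_face_iff (i : ZMod 3) (s : Bool) (y : Pt) :
    y ∈ face i s ↔ y = (0, i, s) ∨ y = (1, i, !s) ∨ y = (2, i, !s) ∨ y = (3, i, !s) := by
  rw [face]
  simp only [Finset.mem_insert, Finset.mem_singleton]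

/-- The conjugate pair of `(b, i, s)` is `{(b, i, s), (b, i, ¬s)}`. [folklore] -/
theorem mem_conjPair_iff' (b : Fin 4) (i : ZMod 3) (s : Bool) (y : Pt) :
    y ∈ conjPair (b, i, s) ↔ y = (b, i, s) ∨ y = (b, i, !s) := by
  rw [mem_conjPair_iff, act_conj]

/-! ### Sanity of the model -/

set_option maxRecDepth 8000 in
/-- `phi` is a CM type for `c = act 0 false (true,true,true)` (exactly one of `x`, `c·x` lies in it), and `c` is a
fixed-point-free involution. [folklore] -/
theorem isCMType_phi : (∀ x : Pt, (x ∈ phi ↔ act 0 false (true, true, true) x ∉ phi)) ∧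
    (∀ x : Pt, act 0 false (true, true, true) (act 0 false (true, true, true) x) = x) ∧
    (∀ x : Pt, act 0 false (true, true, true) x ≠ x) := by
  refine ⟨by decide +kernel, by decide +kernel, by decide +kernel⟩

set_option maxRecDepth 32000 in
set_option maxHeartbeats 4000000 in
/-- **The generating weights are balanced** for all 48 maps (hence for the 24): the conjugate pairs, and the faces —
four points, two of them in the type (Hodge type `(2,2)`).  [cite: Pohlmann1968, Thm 1] [cite: GaoUllmo2025, Thm 3.1] -/
theorem gens_balanced : (∀ x : Pt, balanced (conjPair x) = true) ∧
    (∀ i : ZMod 3, ∀ s : Bool, balanced (face i s) = true ∧ (face i s).card = 4 ∧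
      ((face i s).filter fun x => x ∈ phi).card = 2) := by
  refine ⟨by decide +kernel, by decide +kernel⟩

/-- Every generating weight is balanced, for both groups. [cite: GaoUllmo2025, Thm 3.1] -/
theorem balanced_of_mem_gens {g : Finset Pt} (hg : g ∈ gens) : balanced g = true ∧ balanced₂₄ g = true := by
  have h : balanced g = true := by
    rcases (mem_gens_iff g).1 hg with ⟨x, rfl⟩ | ⟨i, s, rfl⟩
    · exact gens_balanced.1 x
    · exact (gens_balanced.2 i s).1
  exact ⟨h, balanced₂₄_of_balanced h⟩

set_option maxRecDepth 32000 in
set_option maxHeartbeats 4000000 in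
/-- The six faces form ONE orbit under the 24 maps `act j false e` already (so under either Galois group the face
species is a single Galois orbit of weights: ONE rational Hodge class of `X₀ × X₁ × X₂ × X₃` up to its conjugates).
[cite: Pohlmann1968, Thm 1] -/
theorem face_orbit : ∀ i i' : ZMod 3, ∀ s s' : Bool, ∃ g : ZMod 3 × (Bool × Bool × Bool),
    (face i s).image (act g.1 false g.2) = face i' s' := by
  decide +kernel

/-! ### The census of `Q = X₀ × X₁ × X₂ × X₃` in degree 1 -/

set_option maxRecDepth 32000 in
set_option maxHeartbeats 8000000 in
/-- **Degree 1**: a balanced 2-set (for the 24 maps, a fortiori for the 48) is a conjugate pair — `B¹(Q) = D¹(Q)`, Picard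
number 12.  (Stated pointwise: `powersetCard` over the 24 points is too slow for a kernel `decide`.) [cite: Pohlmann1968, Thm 1] -/
theorem balanced_two_classification : ∀ x y : Pt, x ≠ y → balanced₂₄ {x, y} = true →
    y = act 0 false (true, true, true) x := by
  decide +kernel

end Summit.HodgeConjecture.CorCM.Census.PairFlipSexticFourCore
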